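import Summits.BirchSwinnertonDyer.Rank1Residual.F1Sign2.OddBranchFEAtTwoPrelim
import Literature.NumberTheory.EllipticCurves.GreenbergVatsal2000.NonPrimitivePAdicLFunction
import HarnessLib

/-!
# Crux `MazurTateCongruenceAtTwoTop` / `MazurTateCongruenceAtTwoR` (stmt-BirchSwinnertonDyer-25797 = 21416 by name,
# route ThetaPartnerAtTwo, K1 row), line `symbol`: the ORIENTED EULER-FACTOR ELEMENT AT A LAYER —
# `𝒫_v^ι = P_v(ℓ⁻¹(1+T)^{−f_ℓ}) ≡ P_v ∘ (ℓ⁻¹(1+X)^{e_v}) (mod ω_n Λ)`, `e_v = (−f_ℓ) mod pⁿ`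
# (lead prover bsd-wall-tp2-p1 g10; `--supports stmt-BirchSwinnertonDyer-25797`; closes nothing)

HONEST FRAMING. THEOREMS about the tree's definitions only (`GreenbergVatsal2000.eulerFactorElementInv`,
`eulerFactorProductInv`, p537332), at EVERY prime `p`; pure `Λ = ℤ_p⟦T⟧`-algebra; nothing about any curve's
`L`-function or Selmer group is asserted; BSD is not proved by any of this. No route file is imported.

WHAT. The oriented depletion factor `E^ι_W(S₀) = ∏_{v∈S₀} P_v(ℓ_v⁻¹(1+T)^{−f_{ℓ_v}}) ∈ Λ` of the crux
`MazurTateCongruenceAtTwoR` is a power series (`(1+T)^{−f_ℓ}` is a binomial series with `p`-adic exponent); at the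
layer `n` it agrees, MODULO `ω_n = (1+T)^{pⁿ} − 1` IN `Λ` (not merely in `ℚ_p⟦T⟧`, where `ω_n` and `T` generate the same
ideal), with the finite-layer POLYNOMIAL `∏_{v∈S₀} P_v ∘ (ℓ_v⁻¹(1+X)^{e_v})`, `e_v = (−f_{ℓ_v} mod pⁿ) ∈ [0, pⁿ)` — the
element `∏ P_v(ℓ_v⁻¹σ_{ℓ_v}⁻¹)` of the layer group ring `ℤ_p[G_n] = ℤ_p[X]/(ω_n)` that the route
ResidualThetaTransportAtTwo types directly (`ThetaLayerLambdaCongruenceAtTwo`). Ingredients: `(1+T)^x ≡ (1+T)^m (mod ω_n)`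
for `x ≡ m (mod pⁿ)` (`F1Sign2.exists_binomialSeries_sub_pow_eq`), `a − b ∣ P(a) − P(b)`, and the product in `Λ/ω_nΛ`;
plus the image of the layer polynomial in `ℚ_p[X]` (`↑(ℓ⁻¹) = ℓ⁻¹` for `ℓ` prime to `p`).

USE. Companion `…MazurTateCongruenceAtTwoROfSymbolLaw`: the crux from the depleted-symbol law (SP2).

References: [GreenbergVatsal2000] §1 p. 9 (display (8)), §2 Prop. (2.4); [MazurTateTeitelbaum1986Invent] §I.13.
-/

set_option linter.dupNamespace false
set_option autoImplicit false

noncomputable section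

open scoped Classical

open Polynomial NumberField IsDedekindDomain
  Literature.NumberTheory.EllipticCurves Literature.NumberTheory.EllipticCurves.GreenbergVatsal2000

namespace Summit.BirchSwinnertonDyer.BirchSwinnertonDyer.Theorems.MazurTateCongruenceAtTwoR



/-! ## §1. The oriented Euler-factor element at a layer: `𝒫_v^ι ≡ P_v ∘ (ℓ⁻¹(1+X)^{e_v}) (mod ω_n Λ)` -/

section EulerLayer

variable {p : ℕ} [hp : Fact p.Prime] (W : WeierstrassCurve ℚ)

/-- `ω_n ∈ Λ` is `(1 + X)^{pⁿ} − 1`. [folklore] -/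
theorem coe_map_cyclotomicOmega (n : ℕ) :
    ((((cyclotomicOmega p n).map (Int.castRingHom ℤ_[p]) : ℤ_[p][X]) : PowerSeries ℤ_[p])) =
      (1 + PowerSeries.X : PowerSeries ℤ_[p]) ^ p ^ n - 1 := by
  simp only [cyclotomicOmega, Polynomial.map_sub, Polynomial.map_pow, Polynomial.map_add, Polynomial.map_X,
    Polynomial.map_one]
  rw [← Polynomial.coeToPowerSeries.ringHom_apply, map_sub, map_pow, map_add, map_one,
    Polynomial.coeToPowerSeries.ringHom_apply, Polynomial.coe_X, add_comm]

/-- **`𝒫_v^ι ≡ P_v ∘ (ℓ⁻¹(1+X)^{e_v}) (mod ω_n Λ)`**, `e_v = (−f_ℓ) mod pⁿ`: the oriented Euler-factor element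
`P_v(ℓ⁻¹(1+T)^{−f_ℓ}) ∈ Λ` agrees modulo `ω_n` with the finite-layer polynomial `P_v(ℓ⁻¹ σ_ℓ⁻¹)`, because
`(1+T)^{−f_ℓ} ≡ (1+T)^{e_v} (mod ω_n)` (`F1Sign2.exists_binomialSeries_sub_pow_eq`) and `a − b ∣ P(a) − P(b)`.
[cite: GreenbergVatsal2000, §1 p. 9 (display (8))] -/
theorem exists_eulerFactorElementInv_sub_coe_eq_mul (v : HeightOneSpectrum (𝓞 ℚ)) (n : ℕ) :
    ∃ ρ : IwasawaAlgebra p, eulerFactorElementInv W p v -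
        ((((W.localPolynomialAt v).map (Int.castRingHom ℤ_[p])).comp
          (C ((Rat.HeightOneSpectrum.natGenerator v : ℤ_[p]).inv) * (X + 1) ^
            (PadicInt.toZModPow n (-(frobeniusExponent p (Rat.HeightOneSpectrum.natGenerator v : ℤ_[p])))).val) :
            ℤ_[p][X]) : PowerSeries ℤ_[p]) =
      (((cyclotomicOmega p n).map (Int.castRingHom ℤ_[p]) : ℤ_[p][X]) : PowerSeries ℤ_[p]) * ρ := by
  set ℓ : ℕ := Rat.HeightOneSpectrum.natGenerator v with hℓ
  set x : ℤ_[p] := -(frobeniusExponent p (ℓ : ℤ_[p])) with hx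
  set e : ℕ := (PadicInt.toZModPow n x).val with he
  set P : ℤ[X] := W.localPolynomialAt v with hP
  set Q : ℤ_[p][X] := C ((ℓ : ℤ_[p]).inv) * (X + 1) ^ e with hQ
  set a : PowerSeries ℤ_[p] := PowerSeries.C ((ℓ : ℤ_[p]).inv) * PowerSeries.binomialSeries ℤ_[p] x with ha
  obtain ⟨q, hq⟩ := Summit.BirchSwinnertonDyer.Rank1Residual.F1Sign2.exists_binomialSeries_sub_pow_eq (p := p)
    (n := n) (x := x) (m := e) (ZMod.natCast_zmod_val _).symm
  -- the two evaluations of `P`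
  have h1 : eulerFactorElementInv W p v = (P.map (algebraMap ℤ (PowerSeries ℤ_[p]))).eval a := by
    rw [eulerFactorElementInv_eq, Polynomial.aeval_def, Polynomial.eval₂_eq_eval_map]
  have hQ' : ((Q : ℤ_[p][X]) : PowerSeries ℤ_[p]) = PowerSeries.C ((ℓ : ℤ_[p]).inv) * (1 + PowerSeries.X) ^ e := by
    rw [hQ, ← Polynomial.coeToPowerSeries.ringHom_apply, map_mul, map_pow, map_add, map_one,
      Polynomial.coeToPowerSeries.ringHom_apply, Polynomial.coeToPowerSeries.ringHom_apply, Polynomial.coe_C,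
      Polynomial.coe_X, add_comm]
  have h2 : ((((P.map (Int.castRingHom ℤ_[p])).comp Q : ℤ_[p][X]) : PowerSeries ℤ_[p])) =
      (P.map (algebraMap ℤ (PowerSeries ℤ_[p]))).eval (Q : PowerSeries ℤ_[p]) := by
    rw [Polynomial.comp, Polynomial.eval₂_map, ← Polynomial.coeToPowerSeries.ringHom_apply, Polynomial.hom_eval₂,
      Polynomial.eval_map]
    congr 1
    exact RingHom.ext_int _ _
  -- `a − ↑Q = ω_n · (C ℓ⁻¹ · q)` divides the difference of the evaluations
  have hab : a - (Q : PowerSeries ℤ_[p]) = (((cyclotomicOmega p n).map (Int.castRingHom ℤ_[p]) : ℤ_[p][X]) :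
      PowerSeries ℤ_[p]) * (PowerSeries.C ((ℓ : ℤ_[p]).inv) * q) := by
    rw [hQ', ha, ← mul_sub, hq, coe_map_cyclotomicOmega]; ring
  obtain ⟨c, hc⟩ := Polynomial.sub_dvd_eval_sub a (Q : PowerSeries ℤ_[p]) (P.map (algebraMap ℤ (PowerSeries ℤ_[p])))
  refine ⟨PowerSeries.C ((ℓ : ℤ_[p]).inv) * q * c, ?_⟩
  rw [h1, h2, hc, hab]
  ring

end EulerLayer

/-! ## §2. The oriented Euler-factor PRODUCT at a layer, and its image in `ℚ_p[X]` -/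

section EulerProduct

variable {p : ℕ} [hp : Fact p.Prime] (W : WeierstrassCurve ℚ)

/-- **`∏_{v∈S₀} 𝒫_v^ι ≡ ∏_{v∈S₀} P_v ∘ (ℓ_v⁻¹(1+X)^{e_v}) (mod ω_n Λ)`** (product of the one-place congruences
`exists_eulerFactorElementInv_sub_coe_eq_mul`, in `Λ/ω_nΛ`). [cite: GreenbergVatsal2000, §1 p. 9 (display (8))] -/
theorem exists_eulerFactorProductInv_sub_coe_prod_eq_mul (S₀ : Finset (HeightOneSpectrum (𝓞 ℚ))) (n : ℕ) :
    ∃ ρ : IwasawaAlgebra p, eulerFactorProductInv W p S₀ -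
        ((∏ v ∈ S₀, ((W.localPolynomialAt v).map (Int.castRingHom ℤ_[p])).comp
          (C ((Rat.HeightOneSpectrum.natGenerator v : ℤ_[p]).inv) * (X + 1) ^
            (PadicInt.toZModPow n (-(frobeniusExponent p (Rat.HeightOneSpectrum.natGenerator v : ℤ_[p])))).val) :
            ℤ_[p][X]) : PowerSeries ℤ_[p]) =
      (((cyclotomicOmega p n).map (Int.castRingHom ℤ_[p]) : ℤ_[p][X]) : PowerSeries ℤ_[p]) * ρ := by
  set ωΛ : IwasawaAlgebra p := (((cyclotomicOmega p n).map (Int.castRingHom ℤ_[p]) : ℤ_[p][X]) : PowerSeries ℤ_[p])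
    with hωΛ
  set I : Ideal (IwasawaAlgebra p) := Ideal.span {ωΛ} with hI
  set F : HeightOneSpectrum (𝓞 ℚ) → ℤ_[p][X] := fun v ↦ ((W.localPolynomialAt v).map (Int.castRingHom ℤ_[p])).comp
    (C ((Rat.HeightOneSpectrum.natGenerator v : ℤ_[p]).inv) * (X + 1) ^
      (PadicInt.toZModPow n (-(frobeniusExponent p (Rat.HeightOneSpectrum.natGenerator v : ℤ_[p])))).val) with hF
  have hv : ∀ v ∈ S₀, Ideal.Quotient.mk I (eulerFactorElementInv W p v) =
      Ideal.Quotient.mk I ((F v : ℤ_[p][X]) : PowerSeries ℤ_[p]) := by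
    intro v _
    obtain ⟨ρ, hρ⟩ := exists_eulerFactorElementInv_sub_coe_eq_mul W v n (p := p)
    rw [Ideal.Quotient.eq, hI, Ideal.mem_span_singleton]
    exact ⟨ρ, hρ⟩
  have hprod : Ideal.Quotient.mk I (eulerFactorProductInv W p S₀) =
      Ideal.Quotient.mk I (((∏ v ∈ S₀, F v : ℤ_[p][X]) : PowerSeries ℤ_[p])) := by
    rw [eulerFactorProductInv_eq_prod, map_prod, Finset.prod_congr rfl hv, ← map_prod]
    congr 1
    show ∏ x ∈ S₀, Polynomial.coeToPowerSeries.ringHom (F x) = Polynomial.coeToPowerSeries.ringHom (∏ v ∈ S₀, F v)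
    rw [map_prod]
  rw [Ideal.Quotient.eq, hI, Ideal.mem_span_singleton] at hprod
  exact hprod

/-- `↑(ℓ⁻¹) = ℓ⁻¹`: the `p`-adic integer inverse (`PadicInt.inv`) of a natural number prime to `p`, read in `ℚ_p`.
[folklore] -/
theorem coe_inv_natCast {ℓ : ℕ} (hℓ : p.Coprime ℓ) : (((ℓ : ℤ_[p]).inv : ℤ_[p]) : ℚ_[p]) = ((ℓ : ℚ_[p]))⁻¹ := by
  have h1 : ‖(ℓ : ℤ_[p])‖ = 1 := by
    rw [PadicInt.norm_def, PadicInt.coe_natCast, Padic.norm_natCast_eq_one_iff]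
    exact hℓ
  have h2 := PadicInt.mul_inv h1
  have h3 : ((ℓ : ℤ_[p]) : ℚ_[p]) * (((ℓ : ℤ_[p]).inv : ℤ_[p]) : ℚ_[p]) = 1 := by
    rw [← PadicInt.coe_mul, h2, PadicInt.coe_one]
  rw [PadicInt.coe_natCast] at h3
  exact (eq_inv_of_mul_eq_one_right h3)

/-- The finite-layer Euler polynomial over `ℤ_p` maps to the one over `ℚ_p` (`↑(ℓ⁻¹) = ℓ⁻¹` for `ℓ` prime to `p`).
[cite: GreenbergVatsal2000, §1 p. 9 (display (8))] -/
theorem map_localPolynomial_comp_eq (v : HeightOneSpectrum (𝓞 ℚ)) (hℓ : p.Coprime (Rat.HeightOneSpectrum.natGenerator v))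
    (e : ℕ) :
    (((W.localPolynomialAt v).map (Int.castRingHom ℤ_[p])).comp
        (C ((Rat.HeightOneSpectrum.natGenerator v : ℤ_[p]).inv) * (X + 1) ^ e)).map (algebraMap ℤ_[p] ℚ_[p]) =
      ((W.localPolynomialAt v).map (Int.castRingHom ℚ_[p])).comp
        (C ((Rat.HeightOneSpectrum.natGenerator v : ℚ_[p])⁻¹) * (X + 1) ^ e) := by
  have hic : (algebraMap ℤ_[p] ℚ_[p]).comp (Int.castRingHom ℤ_[p]) = Int.castRingHom ℚ_[p] := RingHom.ext_int _ _
  have hinv : algebraMap ℤ_[p] ℚ_[p] ((Rat.HeightOneSpectrum.natGenerator v : ℤ_[p]).inv) =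
      ((Rat.HeightOneSpectrum.natGenerator v : ℚ_[p]))⁻¹ := coe_inv_natCast hℓ
  rw [Polynomial.map_comp, Polynomial.map_mul, Polynomial.map_pow, Polynomial.map_add, Polynomial.map_X,
    Polynomial.map_one, Polynomial.map_C, Polynomial.map_map, hic, hinv]

end EulerProduct

end Summit.BirchSwinnertonDyer.BirchSwinnertonDyer.Theorems.MazurTateCongruenceAtTwoR

end
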